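import Summits.QuantumFields.YangMills.Theorems.AllWindowsColdBoxBoxHighLineGhostDetRatio
import Summits.QuantumFields.YangMills.Theorems.AllWindowsColdBoxBoxHighLineTiltSupBoundsBeta
import Summits.QuantumFields.YangMills.Theorems.AllWindowsColdBoxBoxHighLineGhostTaylor

/-!
# T-S5.6 `smallFieldInsideFP : SmallFieldInsideFP` BY NAME (unconditional) and the §5 sup bound made unconditional by ✓T-S5.7d `ghostTaylor`
# (ASSEMBLY-S5 §4 Step C / §5; planner ym-idea-2 g18 routing 20:00:40Z (c) and 20:15:08Z; LINE-19 S5 ⟨stmt-QuantumFields-24004⟩/⟨24335⟩, LINE-20 U5 ⟨24336⟩)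

Width seat `ym-line-sfw-p2-w4` (prover-ym-line-sfw-p2-w4-g28-0).  One-liners over w3 g40's ✓`ghostTaylor : GhostTaylor` (p744274):

* ★★★ **`smallFieldInsideFP : SmallFieldInsideFP`** — the Step-2 task Prop T-S5.6 of ✓`…Step2Defs`, closed by name
  (`smallFieldInsideFP_of_ghostTaylor ghostTaylor` = w4 g27's ✓`SmallFieldFP.smallFieldInsideFP_of` + w2 g31's ✓`actionSandwich` (6a) + 6b below);
* (6b unconditionally is w3 g40's ✓`ghostLogRatio_sub_le`, same statement as `TiltSup.detRatio_of_ghostTaylor ghostTaylor` — not restated);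
* ★ `TiltSup.abs_tiltU_le` / `TiltSup.exists_forall_abs_tiltU_le_one` — ASSEMBLY §5 `sup_D |tiltU|` unconditionally, resp. `≤ 1` for `β ≥ β₀` in the §1 parameters.

Everything proved; no definitions; standard axioms.  HONEST LABEL: T-S5.6 is ONE task of STEP 2 of the XL stub S5 (`stub_landauSecondOrder`) of a critic-PASSed
DRAFT line; S5, U5, ⟨24004⟩ ⟨24335⟩ ⟨24336⟩ remain OPEN; no crux, rung or summit is proved; the Yang–Mills mass gap is NOT proved by this file.
-/

set_option autoImplicit false

namespace Summit.QuantumFields.YangMills.Theorems.AllWindowsColdBoxBoxHighLine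

/-- ★★★ **T-S5.6 `SmallFieldInsideFP` BY NAME**: inside the Faddeev–Popov chart weight the complement of the small-field box is exponentially rare
(✓`smallFieldInsideFP_of_ghostTaylor` fed with w3 g40's ✓`ghostTaylor`). -/
theorem smallFieldInsideFP : SmallFieldInsideFP := smallFieldInsideFP_of_ghostTaylor ghostTaylor

namespace TiltSup

/- 6b unconditionally (`detRatio_of_ghostTaylor ghostTaylor`) is NOT restated here: w3 g40 landed the same statement as ✓`ghostLogRatio_sub_le`
(`…GhostLogRatio.lean`); cite that name. -/

/-- ★ **ASSEMBLY-S5 §5 sup bound, unconditional**: `|tiltU β H a| ≤ C·(1+log H)^m·(|β|·H⁴·s³ + H⁶·s²)` on `smallField H s`, `0 ≤ s ≤ 1`, `s·H² ≤ c₀`. -/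
theorem abs_tiltU_le :
    ∃ C c₀ : ℝ, ∃ m : ℕ, 0 < c₀ ∧ ∀ H : ℕ, 1 ≤ H → ∀ β s : ℝ, 0 ≤ s → s ≤ 1 → s * (H : ℝ) ^ 2 ≤ c₀ →
      ∀ a ∈ smallField H s, |tiltU β H a| ≤ C * (1 + Real.log H) ^ m * (|β| * (H : ℝ) ^ 4 * s ^ 3 + (H : ℝ) ^ 6 * s ^ 2) :=
  abs_tiltU_le_of ghostTaylor

/-- ★ **`sup_D |tiltU| ≤ 1` for `β ≥ β₀`, unconditional**, in the §1 parameters (`0 < θ`, `12θ < 1`, `κ₃ < (1/2 − 4θ)/3`, `s = β^{−1/2+κ₃}`, `1 ≤ H ≤ β^θ + 1`). -/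
theorem exists_forall_abs_tiltU_le_one {θ κ₃ : ℝ} (hθ : 0 < θ) (h12 : 12 * θ < 1) (hκu : κ₃ < (1 / 2 - 4 * θ) / 3) :
    ∃ β₀ : ℝ, 1 ≤ β₀ ∧ ∀ β : ℝ, β₀ ≤ β → ∀ H : ℕ, 1 ≤ H → (H : ℝ) ≤ β ^ θ + 1 →
      ∀ a ∈ smallField H (β ^ (-1 / 2 + κ₃)), |tiltU β H a| ≤ 1 :=
  exists_forall_abs_tiltU_le ghostTaylor hθ h12 hκu one_pos

end TiltSup

end Summit.QuantumFields.YangMills.Theorems.AllWindowsColdBoxBoxHighLine
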